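import Summits.AtomisticToContinuum.Crystallization.Theorems.FrustratedLawDichotomyStrainedPatchHomValueT2Kit

/-!
# G5′ second edition: the value leaf with LIPSCHITZ (path-linear) Hessian remainders — per-label THIRD-derivative hulls, Hessian at the centre POINT
# (27623 `(H) HomFloor`, hcp half; decomp-a2c hand-1 g41 — sequel of `…HomValueT2Kit`, same critic rows)

MEASURED with the first edition (`valueLeafT2`, value hulls of the Hessian over the block boxes): at `2⁻⁷ × r_ξ = 10⁻²` the Hessian-radius penalty
`½ Σ rad_kl w_k w_l` is `1.1·10⁻²` surplus (t/t_b = 1.5) against an available `2.3·10⁻³`; the honest LABEL-WISE first-order variation is `≈ ½` of the kit's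
hull and the label-summed (cancelling) variation `≈ ¼`.  Two exact factors are left on the table by a VALUE hull: along a linear path from the centre the
deviation `H(x_c + sδ) − H(x_c)` grows LINEARLY in `s` wherever the label's radius stays inside one regime (`W₄₅` is `C³` there), so the second-order
remainder `∫₀¹ (1 − s) δᵀ(H(s) − H(0))δ ds` costs `(1/6)·Λ[δ]³` (not `(1/2)·rad[δ]²`), and the first-order gradient transport of block (ii) costs `(1/2)·Λ`
(not `1·rad`), where `Λ_klm ≥ |∂_m H_kl|` on the box is a per-label THIRD-DERIVATIVE hull:

  `T_abm = (α′/ρ) ζ_a ζ_b ζ_m + α (ν_am ζ_b + ν_bm ζ_a + ν_ab ζ_m) + β ω_abm`,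
  `ζ_a = y·∂_a y`, `ν_ab = ∂_a y·∂_b y + y·∂_a∂_b y`, `ω_abm = Σ_cyc ∂_m∂_a y · ∂_b y` (`y = Uq` is bilinear in `(U, ξ)`, so `∂³y = 0`),

with `(α, α′ρ)` from `…HomCurvCoeff3.ljTripleFI / bumpTripleFI` (monotone endpoint hulls below `q = 1.64`).  Labels whose `ρ`-range on the box meets a
junction (`8/5`, `3`) or the window keep the VALUE hull (class `rad0`, charged `½`).  The Hessian `H^c` and the gradient are now evaluated at the centre
POINT (both families; no hull-midpoint bias).  LEAF BOUND: `LB = V₀ + boxMin(H^c) − penG − penP − penL − pen0` with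
`penL = (1/6)Σ_{klm∈U} Λ^F www + ½ Σ_{kl∈U, m∈ξ} Λ^F www + ½ Σ_{k∈U; i,m∈ξ} Λ^M www + (1/6) Σ_{ijm∈ξ} Λ^M www` (`F` = full box, both families;
`M = U_c × Ξ`, `B` family), `pen0 = ½ Σ rad0 ww`, `penP` = the point-interval widths of `H^c`.

MEASURED (native, worst ray, level μ₇₄, surplus units = SC-units/2SC; hand-1 g41 FINDING): `t_leaf ≈ 16 s` marginal (`21–22 s` per one-box file);
`2⁻⁸ × r_ξ = 10⁻²`: t/t_b = 1.3 `+2.7·10⁻⁴`, 1.4 `+1.0·10⁻³`, 1.5 `+1.7·10⁻³`, 2.0 `+5.5·10⁻³` (first edition: `−1.2·10⁻³ / −0.5·10⁻³ / +0.2·10⁻³ / +4.0·10⁻³`);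
`2⁻⁷ × 10⁻²`: `−6.3 / −5.6 / −2.1·10⁻³` at 1.4 / 1.5 / 2.0, `+1.2·10⁻³` at 2.5; `2⁻⁷ × 5·10⁻³` passes from t/t_b = 2.0 (`+1.4·10⁻³`).  The binding term is the
label-wise `{U,U,ξ}` / `{U,U,U}` third-derivative mass of the twelve nearest neighbours (`α′ρ ≈ −400` at `ρ ≈ 0.95`).  §12 (joint segment, every
third-order term at `1/6`) is measured IDENTICAL to §10–§11 by weight symmetry (same multiset weights) and slightly looser (full-box `Λ` for the `ξ`
blocks); it is retained because its soundness statement is ONE multivariate segment expansion (the simplest (I1) target).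

DEFINITIONS ONLY (computable); soundness = (I1).  0 sorry; no instances / notation / `#eval`.  `--supports stmt-AtomisticToContinuum-27623`.
-/

namespace Summit.AtomisticToContinuum.Crystallization.Theorems.FrustratedLawDichotomyStrainedPatchHomValueT2Kit

open Literature.Analysis.ValidatedNumerics.Numerics
open Summit.AtomisticToContinuum.Crystallization.Theorems.FrustratedLawDichotomyStrainedPatchHomEntryGram (entryFI cen rad)
open Summit.AtomisticToContinuum.Crystallization.Theorems.FrustratedLawDichotomyStrainedPatchHomEntryGramHcp (dot3 shufFI)
open Summit.AtomisticToContinuum.Crystallization.Theorems.FrustratedLawDichotomyStrainedPatchHomCurvCoeff (coeffFI2 alphaLJFI wFI rhoFI bumpS54FI)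
open Summit.AtomisticToContinuum.Crystallization.Theorems.FrustratedLawDichotomyStrainedPatchHomCurvCoeff3 (ljTripleFI bumpTripleFI bumpTFI k75 bumpWT1FI)
open Summit.AtomisticToContinuum.Crystallization.Theorems.FrustratedLawDichotomyStrainedPatchHomCurvLeaf (boxLabels7)
open Summit.AtomisticToContinuum.Crystallization.Theorems.FrustratedLawDichotomyStrainedPatchHomCurvCentreKit (boxE cenE cenX zW)
open Summit.AtomisticToContinuum.Crystallization.Theorems.FrustratedLawDichotomyStrainedPatchHomHertzN (psdTestN)

/-! ## §8. Tight `α′ρ` and the Lipschitz class of a label -/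

/-- `α′_LJ ρ = −224q⁻⁸ + 80q⁻⁵` on `[Q.lo, Q.hi]`: increasing for `q < (112/25)^{1/3} ≈ 1.648` ⇒ thin endpoint hull there, else the naive closed form. -/
def alpha1LJHull (Q : FI) : Option FI :=
  match ljTripleFI (thin Q.lo), ljTripleFI (thin Q.hi), ljTripleFI Q with
  | some t1, some t2, some tn => if Q.hi ≤ qc 164 100 then some ⟨t1.2.1.lo, t2.2.1.hi⟩ else some tn.2.1
  | _, _, _ => none

/-- Per-label coefficient data with class flag: `(α, β, α′/ρ)`; `lip = true` iff the `ρ²`-range lies inside ONE regime (bump or Lennard-Jones), where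
`W₄₅` is `C³` and the third-derivative hull is valid; junction / window labels get `lip = false` (value-hull class). -/
structure CoefL where
  /-- `α` -/
  al : FI
  /-- `β` -/
  be : FI
  /-- `α′/ρ` (meaningful iff `lip`) -/
  a1 : FI
  /-- Lipschitz class -/
  lip : Bool

/-- ★ The classed coefficients of a label from `Q ∋ ρ²`. -/
def coefL (Q : FI) : Option CoefL :=
  match coeffT Q with
  | none => none
  | some ab =>
    if Q.lo ≤ 0 then none
    else if Q.hi < qc 64 25 then
      -- bump regime: α′ρ = α′_LJ ρ − (75/2048)·w T′(w), w = 5ρ/4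
      match alpha1LJHull Q, FI.divPos (FI.ofInt 1) Q with
      | some a1r, some u => some ⟨ab.1, ab.2, (a1r.sub (k75 (bumpWT1FI (wFI (rhoFI Q))))).mul u, true⟩
      | _, _ => some ⟨ab.1, ab.2, fi0, false⟩
    else if qc 65 25 ≤ Q.lo ∧ Q.hi < 9 * (SC : ℤ) then
      match alpha1LJHull Q, FI.divPos (FI.ofInt 1) Q with
      | some a1r, some u => some ⟨ab.1, ab.2, a1r.mul u, true⟩
      | _, _ => some ⟨ab.1, ab.2, fi0, false⟩
    else some ⟨ab.1, ab.2, fi0, false⟩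

/-! ## §9. Per-label generic derivative data in folded coordinates: `ζ`, `ν`, `ω`, Hessian `H`, third derivatives `T` -/

/-- First derivatives of `y`: `(∂_a y)_c` for the folded coordinate `a < 9` (`U`-pairs: `q`-entries; `ξ_i`: the column `U_{·i}` of the entry box). -/
def d1 (E : Fin 3 × Fin 3 → FI) (q : Fin 3 → FI) (a : ℕ) (c : Fin 3) : FI :=
  if a < 6 then (memU a).foldl (fun s cd => if cd.1 = c then s.add (q cd.2) else s) fi0
  else if h : a - 6 < 3 then E (c, ⟨a - 6, h⟩) else fi0

/-- Mixed second derivatives of `y` (constants `0/1/2`): `(∂_a ∂_b y)_c` is nonzero only for a `U`-pair and a `ξ`-index. -/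
def d2 (a b : ℕ) (c : Fin 3) : ℤ :=
  let f := fun (k i : ℕ) => (memU k).foldl (fun s cd => if cd.1 = c ∧ cd.2.val + 6 = i then s + 1 else s) (0 : ℤ)
  if a < 6 ∧ 6 ≤ b then f a b else if b < 6 ∧ 6 ≤ a then f b a else 0

/-- Symmetric `9 × 9` index: position of the unordered pair `{a, b}` in a row-major array (the lower triangle mirrors the upper). -/
def sIx (a b : ℕ) : ℕ := if a ≤ b then 9 * a + b else 9 * b + a

/-- Per-label derivative record: `ζ` (9), `ν` (81), classed coefficients, and the precomputed tables `P_ab = (α′/ρ) ζ_a ζ_b + α ν_ab`, `R_ab = α ν_ab`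
(so that `T_abm = ζ_m P_ab + R_am ζ_b + R_bm ζ_a + β ω_abm` costs four products). -/
structure DRec where
  /-- `y = Uq` -/
  y : Fin 3 → FI
  /-- `∂y` table, `27` entries `3a + c` -/
  dy : Array FI
  /-- `ζ_a = y·∂_a y` -/
  ze : Array FI
  /-- `ν_ab` -/
  nu : Array FI
  /-- coefficients -/
  co : CoefL
  /-- `P_ab` table (81) -/
  pt : Array FI
  /-- `R_ab = α ν_ab` table (81) -/
  rt : Array FI

/-- Build the derivative record of a label with argument `q` over the entry box `E`; `top = 6` for an `A`-family label (no `ξ`-dependence: only the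
`U` coordinates are tabulated), `top = 9` for a `B` label.  Symmetric tables are filled on `a ≤ b` only (read through `sIx`). -/
def mkDRec (top : ℕ) (E : Fin 3 × Fin 3 → FI) (q : Fin 3 → FI) : Option DRec :=
  let qt := tab3 q
  let y := tab3 (yOf E qt)
  match coefL (dot3 y y) with
  | none => none
  | some co =>
    let dy : Array FI := Array.ofFn fun n : Fin 27 => if n.val / 3 < top then d1 E qt (n.val / 3) ⟨n.val % 3, by omega⟩ else fi0
    let gd := fun (a : ℕ) (c : ℕ) => dy.getD (3 * a + c) fi0
    let ze : Array FI := Array.ofFn fun a : Fin 9 =>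
      if a.val < top then (((y 0).mul (gd a.val 0)).add ((y 1).mul (gd a.val 1))).add ((y 2).mul (gd a.val 2)) else fi0
    let nu : Array FI := Array.ofFn fun n : Fin 81 =>
      let a := n.val / 9
      let b := n.val % 9
      if a ≤ b ∧ b < top then
        let dd := (((gd a 0).mul (gd b 0)).add ((gd a 1).mul (gd b 1))).add ((gd a 2).mul (gd b 2))
        let yd := (((y 0).mulInt (d2 a b 0)).add ((y 1).mulInt (d2 a b 1))).add ((y 2).mulInt (d2 a b 2))
        dd.add yd
      else fi0
    let gz := fun (a : ℕ) => ze.getD a fi0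
    let pt : Array FI := Array.ofFn fun n : Fin 81 =>
      let a := n.val / 9
      let b := n.val % 9
      if a ≤ b ∧ b < top then (co.a1.mul ((gz a).mul (gz b))).add (co.al.mul (nu.getD n.val fi0)) else fi0
    let rt : Array FI := Array.ofFn fun n : Fin 81 =>
      let a := n.val / 9
      let b := n.val % 9
      if a ≤ b ∧ b < top then co.al.mul (nu.getD n.val fi0) else fi0
    some ⟨y, dy, ze, nu, co, pt, rt⟩

/-- `ζ_a`, `ν_ab`, `(∂_a y)_c` readers. -/
def DRec.z (R : DRec) (a : ℕ) : FI := R.ze.getD a fi0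
/-- see `DRec.z` -/
def DRec.n (R : DRec) (a b : ℕ) : FI := R.nu.getD (sIx a b) fi0
/-- see `DRec.z` -/
def DRec.d (R : DRec) (a : ℕ) (c : ℕ) : FI := R.dy.getD (3 * a + c) fi0

/-- `ω_abm = Σ_c [(∂_m∂_a y)_c (∂_b y)_c + (∂_m∂_b y)_c (∂_a y)_c + (∂_a∂_b y)_c (∂_m y)_c]`. -/
def omg (R : DRec) (a b m : ℕ) : FI :=
  (List.range 3).foldl (fun s c =>
    let cc : Fin 3 := ⟨c % 3, by omega⟩
    ((s.add ((R.d b c).mulInt (d2 m a cc))).add ((R.d a c).mulInt (d2 m b cc))).add ((R.d m c).mulInt (d2 a b cc))) fi0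

/-- ★ The per-label Hessian `H_ab = α ζ_a ζ_b + β ν_ab` (`9 × 9`, folded; both families — an `A` label has `ζ_ξ = y·U_{·i}` but NO `ξ`-dependence, so its
`ξ` rows are masked by the caller). -/
def hessOf (R : DRec) (maskX : Bool) : Array FI :=
  let up : Array FI := Array.ofFn fun n : Fin 81 =>
    let a := n.val / 9
    let b := n.val % 9
    if b < a ∨ (maskX ∧ (6 ≤ a ∨ 6 ≤ b)) then fi0 else (R.co.al.mul ((R.z a).mul (R.z b))).add (R.co.be.mul (R.n a b))
  Array.ofFn fun n : Fin 81 => up.getD (sIx (n.val / 9) (n.val % 9)) fi0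

/-- `ω` vanishes unless the triple mixes `U` and `ξ` indices. -/
def omgZero (a b m : ℕ) : Bool := (a < 6 ∧ b < 6 ∧ m < 6) ∨ (6 ≤ a ∧ 6 ≤ b ∧ 6 ≤ m)

/-- ★ The per-label third derivative `T_abm = ζ_m P_ab + R_am ζ_b + R_bm ζ_a + β ω_abm` (see the module docstring). -/
def thirdOf (R : DRec) (a b m : ℕ) : FI :=
  let base := (((R.z m).mul (R.pt.getD (sIx a b) fi0)).add ((R.rt.getD (sIx a m) fi0).mul (R.z b))).add ((R.rt.getD (sIx b m) fi0).mul (R.z a))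
  if omgZero a b m then base else base.add (R.co.be.mul (omg R a b m))

/-! ## §10. Accumulators: point Hessian/gradient, Lipschitz sums `Λ`, value-hull radii `rad0` -/

/-- Leaf accumulator of the second edition (integers in `SC` units unless noted). -/
structure AccL where
  /-- dispatch guard -/
  ok : Bool
  /-- `Σ_b |T_abm|` weighted: the block penalty numerator `Σ Λ_abm w_a w_b w_m · (factor/6)` accumulated as `6×` integer (divide by `6·SC³` at the end) -/
  pen6 : ℤ
  /-- value-hull radius penalty numerator `Σ rad0_ab w_a w_b` (divide by `2·SC²`) -/
  pen0 : ℤ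

/-- Weights (`6 ×` the coefficient of `|T_abm| w_a w_b w_m`) of the FULL-box pass over ORDERED triples (no symmetry reduction): block (iii) `U`-path variation
`(a,b,m ∈ U) → 6·(1/6) = 1`; base-point displacement in `ξ` `(a,b ∈ U, m ∈ ξ) → 6·½ = 3`; else `0`. -/
def wFull (a b m : ℕ) : ℤ := if a < 6 ∧ b < 6 then (if m < 6 then 1 else 3) else 0
/-- Weights (`6 ×` the coefficient) of the `U_c × Ξ` pass over ordered triples: block (ii) gradient transport `(a∈U; b,m∈ξ) → 6·½ = 3` (counted once: the
mirror order `(b∈ξ, a∈U)` gets `0`), block (i) `(a,b,m ∈ ξ) → 6·(1/6) = 1`. -/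
def wMid (a b m : ℕ) : ℤ := if a < 6 ∧ 6 ≤ b ∧ 6 ≤ m then 3 else if 6 ≤ a ∧ 6 ≤ b ∧ 6 ≤ m then 1 else 0

/-- Total ordered weight of the multiset `{a, b, m}`: `Σ wgt` over its DISTINCT ordered arrangements (`|T_abm|` is symmetric, the weights are not). -/
def wSym (wgt : ℕ → ℕ → ℕ → ℤ) (a b m : ℕ) : ℤ :=
  let ps : List (ℕ × ℕ × ℕ) := [(a, b, m), (a, m, b), (b, a, m), (b, m, a), (m, a, b), (m, b, a)]
  (ps.eraseDups).foldl (fun s t => s + wgt t.1 t.2.1 t.2.2) 0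

/-- Accumulate one label: Lipschitz class ⟹ `pen6 += Σ_{a≤b≤m} wSym·|T_abm|·w_a w_b w_m / SC`; value-hull class ⟹ `pen0 += Σ_{ab∈blk} |H_b^{box} − H_b^{pt}|·w_a w_b`. -/
def accLabel (wgt : ℕ → ℕ → ℕ → ℤ) (blk : ℕ → ℕ → Bool) (wf : Array ℤ) (Rbox : DRec) (Hpt : Array FI) (maskX : Bool) (A : AccL) : AccL :=
  if Rbox.co.lip then
    let top : ℕ := if maskX then 6 else 9
    let p : ℤ := (List.range top).foldl (fun s a => (List.range top).foldl (fun s2 b => if b < a then s2 else (List.range top).foldl (fun s3 m =>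
      if m < b then s3 else
        let g := wSym wgt a b m
        if g = 0 then s3 else s3 + g * (thirdOf Rbox a b m).absHi * wf.getD a 0 * wf.getD b 0 / (SC : ℤ) * wf.getD m 0) s2) s) 0
    ⟨A.ok, A.pen6 + p, A.pen0⟩
  else
    let Hb := hessOf Rbox maskX
    let p : ℤ := (List.range 9).foldl (fun s a => (List.range 9).foldl (fun s2 b =>
      if blk a b then
        let I := Hb.getD (9 * a + b) fi0
        let J := Hpt.getD (9 * a + b) fi0
        s2 + max |I.hi - J.lo| |J.hi - I.lo| * wf.getD a 0 * wf.getD b 0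
      else s2) s) 0
    ⟨A.ok, A.pen6, A.pen0 + p⟩

/-- The point data of the box centre: `H^c` (interval, summed over all labels of both families) and gradient. -/
structure PtData where
  /-- guard -/
  ok : Bool
  /-- `H(x_c)` folded `9 × 9` -/
  H : Array FI
  /-- `∇E(x_c)` folded -/
  g : Array FI

/-- ★ Pass P: Hessian and gradient AT THE POINT `(U_c, ξ_c)`, plus the per-label point Hessians needed by the value-hull class (returned as a function
by recomputation — cheap, point boxes). -/
def passP (c : (Fin 3 × Fin 3) ⊕ Fin 3 → ℤ) (LA LB : List (Fin 3 → ℤ)) : PtData :=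
  let E := cenE c
  let X := cenX c
  let step := fun (maskX : Bool) (A : PtData) (R : Option DRec) =>
    match R with
    | none => ⟨false, A.H, A.g⟩
    | some R =>
      let Hb := hessOf R maskX
      let gb : Array FI := Array.ofFn fun a : Fin 9 => if maskX ∧ 6 ≤ a.val then fi0 else R.co.be.mul (R.z a.val)
      ⟨A.ok, addArr 81 A.H Hb, addArr 9 A.g gb⟩
  let A0 : PtData := ⟨true, zeroArr 81, zeroArr 9⟩
  let A1 := LA.foldl (fun A b => step true A (mkDRec 6 E (pA b))) A0
  LB.foldl (fun A b => step false A (mkDRec 9 E (qB X b))) A1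

/-- ★ Pass F (full box, both families; `UU` block) and pass M (`U_c × Ξ`, `B` family; `Uξ`, `ξξ` blocks): the Lipschitz / value-hull penalties. -/
def passFM (c w : (Fin 3 × Fin 3) ⊕ Fin 3 → ℤ) (wf : Array ℤ) (LA LB : List (Fin 3 → ℤ)) : AccL :=
  let EF := boxE c w
  let XF := shufFI c w
  let EP := cenE c
  let XP := cenX c
  let blkUU := fun (a b : ℕ) => decide (a < 6 ∧ b < 6)
  let blkX := fun (a b : ℕ) => decide ((a < 6 ∧ 6 ≤ b) ∨ (6 ≤ a ∧ b < 6) ∨ (6 ≤ a ∧ 6 ≤ b))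
  let one := fun (wgt : ℕ → ℕ → ℕ → ℤ) (blk : ℕ → ℕ → Bool) (maskX : Bool) (A : AccL) (Rb Rp : Option DRec) =>
    match Rb, Rp with
    | some Rb, some Rp => accLabel wgt blk wf Rb (hessOf Rp maskX) maskX A
    | _, _ => ⟨false, A.pen6, A.pen0⟩
  let A0 : AccL := ⟨true, 0, 0⟩
  let A1 := LA.foldl (fun A b => one wFull blkUU true A (mkDRec 6 EF (pA b)) (mkDRec 6 EP (pA b))) A0
  let A2 := LB.foldl (fun A b => one wFull blkUU false A (mkDRec 9 EF (qB XF b)) (mkDRec 9 EP (qB XP b))) A1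
  LB.foldl (fun A b => one wMid blkX false A (mkDRec 9 EP (qB XF b)) (mkDRec 9 EP (qB XP b))) A2

/-- Diagnostic weights: one block type at a time (`k = 0,1,2,3` ↦ UUU/6, UUξ/2, Uξξ/2, ξξξ/6). -/
def wDiag (k : ℕ) (a b m : ℕ) : ℤ :=
  if k = 0 then (if a < 6 ∧ b < 6 ∧ m < 6 then 1 else 0)
  else if k = 1 then (if a < 6 ∧ b < 6 ∧ 6 ≤ m then 3 else 0)
  else if k = 2 then (if a < 6 ∧ 6 ≤ b ∧ 6 ≤ m then 3 else 0)
  else (if 6 ≤ a ∧ 6 ≤ b ∧ 6 ≤ m then 1 else 0)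

/-- Diagnostic: the four Lipschitz penalty parts (SC units) `[UUU/6, UUξ/2 (full box), Uξξ/2, ξξξ/6 (U_c × Ξ)]` and the two value-hull parts `[UU, X]`. -/
def penSplitL (c w : (Fin 3 × Fin 3) ⊕ Fin 3 → ℤ) : List ℤ :=
  let LA := nearA c w
  let LB := nearB c w
  let wf : Array ℤ := Array.ofFn fun p : Fin 9 => foldW w p
  let EF := boxE c w
  let XF := shufFI c w
  let EP := cenE c
  let XP := cenX c
  let blkUU := fun (a b : ℕ) => decide (a < 6 ∧ b < 6)
  let blkX := fun (a b : ℕ) => decide ((a < 6 ∧ 6 ≤ b) ∨ (6 ≤ a ∧ b < 6) ∨ (6 ≤ a ∧ 6 ≤ b))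
  let one := fun (wgt : ℕ → ℕ → ℕ → ℤ) (blk : ℕ → ℕ → Bool) (maskX : Bool) (A : AccL) (Rb Rp : Option DRec) =>
    match Rb, Rp with
    | some Rb, some Rp => accLabel wgt blk wf Rb (hessOf Rp maskX) maskX A
    | _, _ => ⟨false, A.pen6, A.pen0⟩
  let run := fun (k : ℕ) =>
    let A0 : AccL := ⟨true, 0, 0⟩
    if k < 2 then
      let A1 := LA.foldl (fun A b => one (wDiag k) blkUU true A (mkDRec 6 EF (pA b)) (mkDRec 6 EP (pA b))) A0
      LB.foldl (fun A b => one (wDiag k) blkUU false A (mkDRec 9 EF (qB XF b)) (mkDRec 9 EP (qB XP b))) A1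
    else LB.foldl (fun A b => one (wDiag k) blkX false A (mkDRec 9 EP (qB XF b)) (mkDRec 9 EP (qB XP b))) A0
  let d6 := 6 * (SC : ℤ) * (SC : ℤ)
  let d2 := 2 * (SC : ℤ) * (SC : ℤ)
  [cdiv (run 0).pen6 d6, cdiv (run 1).pen6 d6, cdiv (run 2).pen6 d6, cdiv (run 3).pen6 d6, cdiv (run 0).pen0 d2, cdiv (run 2).pen0 d2]

/-- ★ **COMBINED PASS** (one visit per label): point Hessian/gradient (pass P) and the Lipschitz / value-hull penalties of the full box (`UU` block,
both families) and of `U_c × Ξ` (`Uξ`, `ξξ`, `B` family), the point record computed ONCE per label. -/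
def passAll (c w : (Fin 3 × Fin 3) ⊕ Fin 3 → ℤ) (wf : Array ℤ) (LA LB : List (Fin 3 → ℤ)) : PtData × AccL :=
  let EF := boxE c w
  let XF := shufFI c w
  let EP := cenE c
  let XP := cenX c
  let blkUU := fun (a b : ℕ) => decide (a < 6 ∧ b < 6)
  let blkX := fun (a b : ℕ) => decide ((a < 6 ∧ 6 ≤ b) ∨ (6 ≤ a ∧ b < 6) ∨ (6 ≤ a ∧ 6 ≤ b))
  let stepA := fun (S : PtData × AccL) (b : Fin 3 → ℤ) =>
    match mkDRec 6 EP (pA b), mkDRec 6 EF (pA b) with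
    | some Rp, some Rb =>
      let Hp := hessOf Rp true
      let gb : Array FI := Array.ofFn fun a : Fin 9 => if 6 ≤ a.val then fi0 else Rp.co.be.mul (Rp.z a.val)
      (⟨S.1.ok, addArr 81 S.1.H Hp, addArr 9 S.1.g gb⟩, accLabel wFull blkUU wf Rb Hp true S.2)
    | _, _ => (⟨false, S.1.H, S.1.g⟩, ⟨false, S.2.pen6, S.2.pen0⟩)
  let stepB := fun (S : PtData × AccL) (b : Fin 3 → ℤ) =>
    match mkDRec 9 EP (qB XP b), mkDRec 9 EF (qB XF b), mkDRec 9 EP (qB XF b) with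
    | some Rp, some Rb, some Rm =>
      let Hp := hessOf Rp false
      let gb : Array FI := Array.ofFn fun a : Fin 9 => Rp.co.be.mul (Rp.z a.val)
      let A1 := accLabel wFull blkUU wf Rb Hp false S.2
      (⟨S.1.ok, addArr 81 S.1.H Hp, addArr 9 S.1.g gb⟩, accLabel wMid blkX wf Rm Hp false A1)
    | _, _, _ => (⟨false, S.1.H, S.1.g⟩, ⟨false, S.2.pen6, S.2.pen0⟩)
  let S0 : PtData × AccL := (⟨true, zeroArr 81, zeroArr 9⟩, ⟨true, 0, 0⟩)
  LB.foldl stepB (LA.foldl stepA S0)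

/-! ## §11. The second-edition report and verdict -/

/-- ★★ **Second-edition report** `(flag, V₀ − μ, boxMin, penP (point widths + gradient widths), penL, pen0, κ, LB − μ)` in `SC` units. -/
def t2ReportL (μ : ℤ) (c w : (Fin 3 × Fin 3) ⊕ Fin 3 → ℤ) : Bool × ℤ × ℤ × ℤ × ℤ × ℤ × ℤ × ℤ :=
  let LA := nearA c w
  let LB := nearB c w
  let wf : Array ℤ := Array.ofFn fun p : Fin 9 => foldW w p
  let PA := passAll c w wf LA LB
  let P := PA.1
  let A := PA.2
  let Hc : Array ℤ := P.H.map cen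
  let Hr : Array ℤ := P.H.map rad
  let gc : Array ℤ := P.g.map cen
  let gr : Array ℤ := P.g.map rad
  match valueP μ c, kappaShift Hc with
  | some v, some κ =>
    let t := anchor Hc gc wf 40
    let bm := boxMin Hc gc wf κ t
    -- point widths: Σ gr w / SC + ½ Σ Hr w w / SC²
    let pP : ℤ := cdiv ((List.range 9).foldl (fun s k => s + gr.getD k 0 * wf.getD k 0) 0) (SC : ℤ) +
      cdiv ((List.range 9).foldl (fun s k => (List.range 9).foldl (fun s2 l => s2 + (Hr.getD (9 * k + l) 0) * wf.getD k 0 * wf.getD l 0) s) 0)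
        (2 * (SC : ℤ) * (SC : ℤ))
    let pL : ℤ := cdiv A.pen6 (6 * (SC : ℤ) * (SC : ℤ))
    let p0 : ℤ := cdiv A.pen0 (2 * (SC : ℤ) * (SC : ℤ))
    (foldGuard c w && P.ok && A.ok && symOK Hc, v - μ, bm, pP, pL, p0, κ, v + bm - pP - pL - p0 - μ)
  | some v, none => (false, v - μ, 0, 0, 0, 0, -1, 0)
  | none, _ => (false, 0, 0, 0, 0, 0, 0, 0)

/-- ★★★ **THE SECOND-EDITION VERDICT** `valueLeafT2L μ c w`. -/
def valueLeafT2L (μ : ℤ) (c w : (Fin 3 × Fin 3) ⊕ Fin 3 → ℤ) : Bool :=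
  let r := t2ReportL μ c w
  r.1 && decide (0 ≤ r.2.2.2.2.2.2.2)

/-! ## §12. Third edition — the JOINT segment (Design J): ONE full-box pass, factor `1/6` on EVERY third-order term

Along the straight segment `s ↦ x_c + sδ` in all nine coordinates, `E(x) = E(x_c) + ∇E·δ + ∫₀¹ (1 − s) δᵀ∇²E(x_c + sδ)δ ds` and, label by label inside one
regime, `|∇²E_b(x_c + sδ) − ∇²E_b(x_c)| ≤ s·Λ_b[|δ|]` with the SAME third-derivative hull `T_abm` over the full box (the generic `ζ/ν/ω` calculus of §9
already contains the mixed second derivatives of the bilinear `y = Uq`, i.e. it IS the joint third derivative).  Hence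
`E(x) ≥ V₀ + g·δ + ½ δᵀH^c δ − (1/6) Σ_{abm} Λ_abm |δ_a δ_b δ_m| − ½ Σ rad0_ab |δ_a δ_b|` — the `{U,U,ξ}` and `{U,ξ,ξ}` terms drop from `½` to `1/6`
against the three-path composition of §10–§11 (measured at `(1.5, 2⁻⁷, 10⁻²)`: `3.3·10⁻³ + 1.0·10⁻³` of the `7.8·10⁻³` total). -/

/-- Joint-segment weights: every ordered triple `1` (`6 · 1/6`). -/
def wJ (_a _b _m : ℕ) : ℤ := 1

/-- ★ The joint full-box pass (both families; `A` labels masked to the `U` coordinates; value-hull class on all entries). -/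
def passJ (c w : (Fin 3 × Fin 3) ⊕ Fin 3 → ℤ) (wf : Array ℤ) (LA LB : List (Fin 3 → ℤ)) : AccL :=
  let EF := boxE c w
  let XF := shufFI c w
  let EP := cenE c
  let XP := cenX c
  let blkAll := fun (_a _b : ℕ) => true
  let blkUU := fun (a b : ℕ) => decide (a < 6 ∧ b < 6)
  let one := fun (blk : ℕ → ℕ → Bool) (maskX : Bool) (A : AccL) (Rb Rp : Option DRec) =>
    match Rb, Rp with
    | some Rb, some Rp => accLabel wJ blk wf Rb (hessOf Rp maskX) maskX A
    | _, _ => ⟨false, A.pen6, A.pen0⟩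
  let A0 : AccL := ⟨true, 0, 0⟩
  let A1 := LA.foldl (fun A b => one blkUU true A (mkDRec 6 EF (pA b)) (mkDRec 6 EP (pA b))) A0
  LB.foldl (fun A b => one blkAll false A (mkDRec 9 EF (qB XF b)) (mkDRec 9 EP (qB XP b))) A1

/-- ★★ **Third-edition report** `(flag, V₀ − μ, boxMin, penP, penJ, pen0, κ, LB − μ)` in `SC` units. -/
def t2ReportJ (μ : ℤ) (c w : (Fin 3 × Fin 3) ⊕ Fin 3 → ℤ) : Bool × ℤ × ℤ × ℤ × ℤ × ℤ × ℤ × ℤ :=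
  let LA := nearA c w
  let LB := nearB c w
  let wf : Array ℤ := Array.ofFn fun p : Fin 9 => foldW w p
  let P := passP c LA LB
  let Hc : Array ℤ := P.H.map cen
  let Hr : Array ℤ := P.H.map rad
  let gc : Array ℤ := P.g.map cen
  let gr : Array ℤ := P.g.map rad
  let A := passJ c w wf LA LB
  match valueP μ c, kappaShift Hc with
  | some v, some κ =>
    let t := anchor Hc gc wf 40
    let bm := boxMin Hc gc wf κ t
    let pP : ℤ := cdiv ((List.range 9).foldl (fun s k => s + gr.getD k 0 * wf.getD k 0) 0) (SC : ℤ) +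
      cdiv ((List.range 9).foldl (fun s k => (List.range 9).foldl (fun s2 l => s2 + (Hr.getD (9 * k + l) 0) * wf.getD k 0 * wf.getD l 0) s) 0)
        (2 * (SC : ℤ) * (SC : ℤ))
    let pL : ℤ := cdiv A.pen6 (6 * (SC : ℤ) * (SC : ℤ))
    let p0 : ℤ := cdiv A.pen0 (2 * (SC : ℤ) * (SC : ℤ))
    (foldGuard c w && P.ok && A.ok && symOK Hc, v - μ, bm, pP, pL, p0, κ, v + bm - pP - pL - p0 - μ)
  | some v, none => (false, v - μ, 0, 0, 0, 0, -1, 0)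
  | none, _ => (false, 0, 0, 0, 0, 0, 0, 0)

/-- ★★★ **THE THIRD-EDITION VERDICT** `valueLeafT2J μ c w` (joint segment). -/
def valueLeafT2J (μ : ℤ) (c w : (Fin 3 × Fin 3) ⊕ Fin 3 → ℤ) : Bool :=
  let r := t2ReportJ μ c w
  r.1 && decide (0 ≤ r.2.2.2.2.2.2.2)

end Summit.AtomisticToContinuum.Crystallization.Theorems.FrustratedLawDichotomyStrainedPatchHomValueT2Kit
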